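import Summits.FinalStateConjecture.FinalStateConjecture.Theses.PhotonSphereChannels
import Summits.FinalStateConjecture.FinalStateConjecture.Theorems.PhotonSphereChannelsTameEternalLimitDefs
import HarnessLib

/-!
# Route PhotonSphereChannels · crux `ChannelsResolveTameDevelopmentsR` (stmt-FinalStateConjecture-17430, K2R-T2):
# the ray-closure clause (C) of its consequent splits off as the cross-route item `SettledExteriorHoldsRays`

The re-typed crux K2R-T2 reads `K1R → ∀ admissible D, ∀ MGHD 𝒟, complete 𝓘⁺ → ((i) no extremal
remnant ∧ (ii) tame outer region) → ∃ O d, O = exteriorOf 𝒟 d.charted ∧ RaysStayInClosure 𝒟 O ∧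
HasExhaustiveCharts d ∧ IsFutureOriented d`. Its clause (C) `RaysStayInClosure` (every future-complete
normalised null ray from `Σ` stays in `closure O`) is pure causal topology of the MGHD and is the one
conjunct whose truth for multi-topology `Σ = ℝ³ # N` is under review (refuter `BAG.md`, lead line
`Sketch`, idea cards `orphans-behind-the-throat` / `end-visible-rays-quarantine`).

This file records, kernel-checked, that (C) FACTORS OUT of the crux onto a statement that already
exists on the ledger as a `∀`-datum item of two other routes — `SettledExteriorHoldsRays`
(stmt-FinalStateConjecture-17673; `Theses.TangentConeAtIPlus` rank 6 and `Theses.RaychaudhuriBlowdown`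
rank 6): *for every admissible datum, every MGHD with complete `𝓘⁺` and EVERY sub-extremal, honest,
exhaustive, future-oriented `2`-decomposition `fd` of `O = exteriorOf 𝒟 fd.charted`,
`RaysStayInClosure 𝒟 O`*. Precisely (hypothesis `hC` below is the body of that item verbatim, so the
theorems apply to `(h : SettledExteriorHoldsRays)` by `exact`):

* `isSubextremal_of_noExtremalRemnant` — under hypothesis (i) every hole of every
  `FinalStateDecomposition 𝒟 O 2` is sub-extremal (`|aᵢ| ≤ Mᵢ` structurally, and `|aᵢ| = Mᵢ` would
  make the hole chart an extremal remnant) — the step `closes` performs, isolated;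
* `channelsResolveTameDevelopmentsR_of_tameRayClause` — **K2R♭ ∧ (C)♭ ⇒ K2R-T2**, where K2R♭ is the
  crux with (C) deleted from the consequent and (C)♭ is item 17673 weakened to developments
  satisfying (i) ∧ (ii) (the only instances the crux ever inspects);
* `channelsResolveTameDevelopmentsR_of_rayClause` — the same with item 17673 verbatim (registered
  sub-goal of stmt-17430; header on one line = the registered signature);
* `rayClauseFree_of_channelsResolveTameDevelopmentsR` — conversely K2R-T2 ⇒ K2R♭;
* `finalStateConjecture_of_rayClause` — the route's deciding theorem re-keyed:
  `K1R → K2R♭ → SettledExteriorHoldsRays → K3 → FinalStateConjecture` in one line over `closes`;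
* `settleConjunct_of_rayClauseAt`, `settleConjunct_of_rayClauseAt_of_noExtremalRemnant` — the
  POINTWISE form at one development (programme-wide tool: (C) factors out of every settle-type
  consequent of the 59 open items that carry it inline, §Pointwise).

So re-keying stmt-17430 as K2R♭ and adding the EXISTING item stmt-17673 to the route is a
conservative route edit (option (α) of the lead's `ReKey17430.lean` with `NoHiddenItem` replaced by an
item already wanted by two routes); every `--supports` file of 14075/17430 transfers to K2R♭ verbatim
(same hypotheses), and the multi-topology exposure of (C) is then carried by one shared item.

References: M. Dafermos, J. Luk, arXiv:1710.01722, Conjecture 1 and §1.2.1 (the conjecture and its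
tame hypotheses); D. Christodoulou, Class. Quantum Grav. 16 (1999) A23, pp. A26–A27 (complete 𝓘⁺).
-/

-- `Summit.FinalStateConjecture.FinalStateConjecture.…` (summit = sub-problem) is the tree's layout
set_option linter.dupNamespace false

namespace Summit.FinalStateConjecture.FinalStateConjecture.Theorems.ChannelsResolveTameDevelopmentsR.RayClause

open Literature.Geometry.Lorentzian
open scoped Manifold ContDiff Topology

section PerDevelopment

variable {X : Type} [TopologicalSpace X] [ChartedSpace E3 X] [IsManifold (𝓡 3) ∞ X]
  [ConnectedSpace X] {D : InitialDataSet (𝓡 3) X}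

/-- **Sub-extremality of the final holes from hypothesis (i).** If the maximal development `𝒟`
carries no extremal-Kerr late chart with `C²`-deviation tending to `0` on every near-zone slab
(`TrappedSet.NoExtremalRemnant`), then every hole of every `C²` final-state decomposition `d` of any
region `O ⊆ 𝒟` is sub-extremal: `|aᵢ| ≤ Mᵢ` is a field of the decomposition, and `|aᵢ| = Mᵢ`
(with `0 < Mᵢ`) would make the hole chart `d.chart i` itself an extremal remnant. This is the step
the route's deciding theorem `closes` performs inline. [cite: DafermosLuk2017, Conjecture 1] -/
theorem isSubextremal_of_noExtremalRemnant {𝒟 : VacuumCauchyDevelopment D}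
    (hi : TrappedSet.NoExtremalRemnant 𝒟) {O : Set 𝒟.carrier}
    (d : FinalStateDecomposition 𝒟.toSpacetime O 2) :
    ∀ i, Kerr.IsSubextremal (d.mass i) (d.spin i) := by
  intro i
  rcases lt_or_eq_of_le (d.abs_spin_le_mass i) with hlt | heq
  · exact hlt
  · exact absurd ⟨d.τ₀, d.chart i, ⟨(d.isLateChart i).contMDiff, (d.isLateChart i).isOpenEmbedding,
        Set.subset_univ _⟩, d.tendsto_truncDeviationCk i⟩
      (hi (d.motion i).1 (d.motion i).2 (d.mass i) (d.spin i) ⟨heq, d.mass_pos i⟩)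

end PerDevelopment

/-- **K2R♭ ∧ (C)♭ ⇒ K2R-T2.** The crux `ChannelsResolveTameDevelopmentsR` follows from
(a) K2R♭ — the crux with the ray-closure clause (C) deleted from its consequent (hypotheses
byte-identical: K1R, admissible `D`, maximal `𝒟`, complete `𝓘⁺`, (i) `NoExtremalRemnant`,
(ii) `TameOuterRegion`; consequent `∃ O d, O = exteriorOf 𝒟 d.charted ∧ HasExhaustiveCharts d ∧
IsFutureOriented d`), and (b) the ray clause for TAME developments: for every admissible datum, every
MGHD with complete `𝓘⁺` satisfying (i) ∧ (ii), and every sub-extremal `2`-decomposition `fd` with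
`O = exteriorOf 𝒟 fd.charted`, honest exhaustive and future-oriented charts, `RaysStayInClosure 𝒟 O`
— item `SettledExteriorHoldsRays` (stmt-17673) restricted to the developments the crux inspects.
Sub-extremality of the produced decomposition is supplied by `isSubextremal_of_noExtremalRemnant`.
[cite: DafermosLuk2017, Conjecture 1] -/
theorem channelsResolveTameDevelopmentsR_of_tameRayClause
    (hC : ∀ (X : Type) [TopologicalSpace X] [ChartedSpace E3 X] [IsManifold (𝓡 3) ∞ X] [T2Space X]
      [SecondCountableTopology X] [ConnectedSpace X] (D : InitialDataSet (𝓡 3) X),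
      D ∈ admissibleVacuumData X → ∀ 𝒟 : VacuumCauchyDevelopment D, 𝒟.IsMaximal →
      _root_.Summit.FinalStateConjecture.HasCompleteNullInfinity 𝒟.toCauchyDevelopment →
      (TrappedSet.NoExtremalRemnant 𝒟 ∧ TrappedSet.TameOuterRegion 𝒟) →
      ∀ (O : Set 𝒟.carrier) (fd : FinalStateDecomposition 𝒟.toSpacetime O 2),
      (∀ i, Kerr.IsSubextremal (fd.mass i) (fd.spin i)) →
      O = _root_.Summit.FinalStateConjecture.exteriorOf 𝒟.toCauchyDevelopment fd.charted →
      _root_.Summit.FinalStateConjecture.HasExhaustiveCharts fd →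
      _root_.Summit.FinalStateConjecture.IsFutureOriented fd →
      _root_.Summit.FinalStateConjecture.RaysStayInClosure 𝒟.toCauchyDevelopment O)
    (hflat : _root_.Summit.FinalStateConjecture.FinalStateConjecture.Theses.PhotonSphereChannels.UniformPhotonSphereChannelsR →
      ∀ (X : Type) [TopologicalSpace X] [ChartedSpace E3 X] [IsManifold (𝓡 3) ∞ X] [T2Space X]
      [SecondCountableTopology X] [ConnectedSpace X], ∀ D ∈ admissibleVacuumData X,
      ∀ 𝒟 : VacuumCauchyDevelopment D, 𝒟.IsMaximal →
      _root_.Summit.FinalStateConjecture.HasCompleteNullInfinity 𝒟.toCauchyDevelopment →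
      (TrappedSet.NoExtremalRemnant 𝒟 ∧ TrappedSet.TameOuterRegion 𝒟) →
      ∃ (O : Set 𝒟.carrier) (d : FinalStateDecomposition 𝒟.toSpacetime O 2),
        O = _root_.Summit.FinalStateConjecture.exteriorOf 𝒟.toCauchyDevelopment d.charted ∧
        _root_.Summit.FinalStateConjecture.HasExhaustiveCharts d ∧
        _root_.Summit.FinalStateConjecture.IsFutureOriented d) :
    _root_.Summit.FinalStateConjecture.FinalStateConjecture.Theses.PhotonSphereChannels.ChannelsResolveTameDevelopmentsR := by
  intro h₁ X _ _ _ _ _ _ D hD 𝒟 hmax hcomp hyp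
  obtain ⟨O, d, hO, hexh, hfo⟩ := hflat h₁ X D hD 𝒟 hmax hcomp hyp
  exact ⟨O, d, hO, hC X D hD 𝒟 hmax hcomp hyp O d (isSubextremal_of_noExtremalRemnant hyp.1 d)
    hO hexh hfo, hexh, hfo⟩

/-- **K2R♭ ∧ `SettledExteriorHoldsRays` ⇒ K2R-T2.** As `channelsResolveTameDevelopmentsR_of_tameRayClause`,
with hypothesis `hC` now LITERALLY the body of the cross-route item `SettledExteriorHoldsRays`
(stmt-FinalStateConjecture-17673, routes `TangentConeAtIPlus` / `RaychaudhuriBlowdown`): the ray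
clause for every admissible datum, every MGHD with complete `𝓘⁺` and every sub-extremal honest
exhaustive future-oriented `2`-decomposition, with no tameness hypothesis. Hence re-keying the crux
as K2R♭ and importing item 17673 into the route loses nothing. [cite: DafermosLuk2017, Conjecture 1] -/
theorem channelsResolveTameDevelopmentsR_of_rayClause : (∀ (X : Type) [TopologicalSpace X] [ChartedSpace E3 X] [IsManifold (𝓡 3) ∞ X] [T2Space X] [SecondCountableTopology X] [ConnectedSpace X] (D : InitialDataSet (𝓡 3) X), D ∈ admissibleVacuumData X → ∀ 𝒟 : VacuumCauchyDevelopment D, 𝒟.IsMaximal → _root_.Summit.FinalStateConjecture.HasCompleteNullInfinity 𝒟.toCauchyDevelopment → ∀ (O : Set 𝒟.carrier) (fd : FinalStateDecomposition 𝒟.toSpacetime O 2), (∀ i, Kerr.IsSubextremal (fd.mass i) (fd.spin i)) → O = _root_.Summit.FinalStateConjecture.exteriorOf 𝒟.toCauchyDevelopment fd.charted → _root_.Summit.FinalStateConjecture.HasExhaustiveCharts fd → _root_.Summit.FinalStateConjecture.IsFutureOriented fd → _root_.Summit.FinalStateConjecture.RaysStayInClosure 𝒟.toCauchyDevelopment O)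 → (_root_.Summit.FinalStateConjecture.FinalStateConjecture.Theses.PhotonSphereChannels.UniformPhotonSphereChannelsR → ∀ (X : Type) [TopologicalSpace X] [ChartedSpace E3 X] [IsManifold (𝓡 3) ∞ X] [T2Space X] [SecondCountableTopology X] [ConnectedSpace X], ∀ D ∈ admissibleVacuumData X, ∀ 𝒟 : VacuumCauchyDevelopment D, 𝒟.IsMaximal → _root_.Summit.FinalStateConjecture.HasCompleteNullInfinity 𝒟.toCauchyDevelopment → (TrappedSet.NoExtremalRemnant 𝒟 ∧ TrappedSet.TameOuterRegion 𝒟) → ∃ (O : Set 𝒟.carrier) (d : FinalStateDecomposition 𝒟.toSpacetime O 2), O = _root_.Summit.FinalStateConjecture.exteriorOf 𝒟.toCauchyDevelopment d.charted ∧ _root_.Summit.FinalStateConjecture.HasExhaustiveCharts d ∧ _root_.Summit.FinalStateConjecture.IsFutureOriented d) → _root_.Summit.FinalStateConjecture.FinalStateConjecture.Theses.PhotonSphereChannels.ChannelsResolveTameDevelopmentsR := by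
  intro hC hflat
  exact channelsResolveTameDevelopmentsR_of_tameRayClause
    (fun X _ _ _ _ _ _ D hD 𝒟 hmax hcomp _ ↦ hC X D hD 𝒟 hmax hcomp) hflat

/-- **K2R-T2 ⇒ K2R♭** (the converse bracket): deleting the ray-closure clause (C) from the
consequent of the crux is a weakening, so K2R♭ is a corollary of the crux as filed and every negative
finding on K2R♭ transfers to the crux. [cite: DafermosLuk2017, Conjecture 1] -/
theorem rayClauseFree_of_channelsResolveTameDevelopmentsR
    (h : _root_.Summit.FinalStateConjecture.FinalStateConjecture.Theses.PhotonSphereChannels.ChannelsResolveTameDevelopmentsR) :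
    _root_.Summit.FinalStateConjecture.FinalStateConjecture.Theses.PhotonSphereChannels.UniformPhotonSphereChannelsR →
      ∀ (X : Type) [TopologicalSpace X] [ChartedSpace E3 X] [IsManifold (𝓡 3) ∞ X] [T2Space X]
      [SecondCountableTopology X] [ConnectedSpace X], ∀ D ∈ admissibleVacuumData X,
      ∀ 𝒟 : VacuumCauchyDevelopment D, 𝒟.IsMaximal →
      _root_.Summit.FinalStateConjecture.HasCompleteNullInfinity 𝒟.toCauchyDevelopment →
      (TrappedSet.NoExtremalRemnant 𝒟 ∧ TrappedSet.TameOuterRegion 𝒟) →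
      ∃ (O : Set 𝒟.carrier) (d : FinalStateDecomposition 𝒟.toSpacetime O 2),
        O = _root_.Summit.FinalStateConjecture.exteriorOf 𝒟.toCauchyDevelopment d.charted ∧
        _root_.Summit.FinalStateConjecture.HasExhaustiveCharts d ∧
        _root_.Summit.FinalStateConjecture.IsFutureOriented d := by
  intro h₁ X _ _ _ _ _ _ D hD 𝒟 hmax hcomp hyp
  obtain ⟨O, d, hO, -, hexh, hfo⟩ := h h₁ X D hD 𝒟 hmax hcomp hyp
  exact ⟨O, d, hO, hexh, hfo⟩

/-- **The route re-keyed, in one line.** With K2R♭ in place of the crux and the cross-route item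
`SettledExteriorHoldsRays` (stmt-17673, hypothesis `hC` verbatim its body) added, the route's deciding
theorem `Theses.PhotonSphereChannels.closes : K1R → K2R-T2 → K3 → FinalStateConjecture` still closes
the summit: `K1R → K2R♭ → SettledExteriorHoldsRays → TameCensorship → FinalStateConjecture`.
[cite: DafermosLuk2017, Conjecture 1] -/
theorem finalStateConjecture_of_rayClause
    (h₁ : _root_.Summit.FinalStateConjecture.FinalStateConjecture.Theses.PhotonSphereChannels.UniformPhotonSphereChannelsR)
    (hflat : _root_.Summit.FinalStateConjecture.FinalStateConjecture.Theses.PhotonSphereChannels.UniformPhotonSphereChannelsR →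
      ∀ (X : Type) [TopologicalSpace X] [ChartedSpace E3 X] [IsManifold (𝓡 3) ∞ X] [T2Space X]
      [SecondCountableTopology X] [ConnectedSpace X], ∀ D ∈ admissibleVacuumData X,
      ∀ 𝒟 : VacuumCauchyDevelopment D, 𝒟.IsMaximal →
      _root_.Summit.FinalStateConjecture.HasCompleteNullInfinity 𝒟.toCauchyDevelopment →
      (TrappedSet.NoExtremalRemnant 𝒟 ∧ TrappedSet.TameOuterRegion 𝒟) →
      ∃ (O : Set 𝒟.carrier) (d : FinalStateDecomposition 𝒟.toSpacetime O 2),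
        O = _root_.Summit.FinalStateConjecture.exteriorOf 𝒟.toCauchyDevelopment d.charted ∧
        _root_.Summit.FinalStateConjecture.HasExhaustiveCharts d ∧
        _root_.Summit.FinalStateConjecture.IsFutureOriented d)
    (hC : ∀ (X : Type) [TopologicalSpace X] [ChartedSpace E3 X] [IsManifold (𝓡 3) ∞ X] [T2Space X]
      [SecondCountableTopology X] [ConnectedSpace X] (D : InitialDataSet (𝓡 3) X),
      D ∈ admissibleVacuumData X → ∀ 𝒟 : VacuumCauchyDevelopment D, 𝒟.IsMaximal →
      _root_.Summit.FinalStateConjecture.HasCompleteNullInfinity 𝒟.toCauchyDevelopment →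
      ∀ (O : Set 𝒟.carrier) (fd : FinalStateDecomposition 𝒟.toSpacetime O 2),
      (∀ i, Kerr.IsSubextremal (fd.mass i) (fd.spin i)) →
      O = _root_.Summit.FinalStateConjecture.exteriorOf 𝒟.toCauchyDevelopment fd.charted →
      _root_.Summit.FinalStateConjecture.HasExhaustiveCharts fd →
      _root_.Summit.FinalStateConjecture.IsFutureOriented fd →
      _root_.Summit.FinalStateConjecture.RaysStayInClosure 𝒟.toCauchyDevelopment O)
    (h₃ : _root_.Summit.FinalStateConjecture.FinalStateConjecture.Theses.PhotonSphereChannels.TameCensorship) :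
    _root_.FinalStateConjecture :=
  _root_.Summit.FinalStateConjecture.FinalStateConjecture.Theses.PhotonSphereChannels.closes h₁
    (channelsResolveTameDevelopmentsR_of_rayClause hC hflat) h₃

/-! ### Programme-wide form: the ray clause factors out of EVERY settle-type consequent

The split is not special to this route. Across the 56 route files of the summit, 83 open items
conclude a `FinalStateDecomposition`; 59 of them carry `RaysStayInClosure` inline in the consequent
(44 as `∀`-datum claims, 15 inside a genericity quantifier), and exactly one item — stmt-17673 —
isolates it. The two per-development lemmas below are the uniform tool: for ONE maximal development
with complete `𝓘⁺` of an admissible datum, the summit's T2 settle conjunct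
`∃ O d, (∀ i, sub-extremal) ∧ O = exteriorOf ∧ RaysStayInClosure ∧ HasExhaustiveCharts ∧ IsFutureOriented`
follows from its (C)-free form and the instance of item 17673 at that development (resp. from the
(C)-free form WITHOUT sub-extremality, hypothesis (i), and that instance). Any route whose crux has
`IsMaximal` and complete `𝓘⁺` among its hypotheses or conclusions can therefore delete (C) from the
crux and import stmt-17673, its `closes` gaining one line per development. -/

section Pointwise

/-- **Pointwise ray-clause factoring (sub-extremal form).** For one vacuum Cauchy development `𝒟`
(in applications: a maximal development with complete `𝓘⁺` of an admissible datum): if SOME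
sub-extremal `2`-decomposition `d` of `O = exteriorOf 𝒟 d.charted` has honest exhaustive,
future-oriented charts, and the ray clause of item `SettledExteriorHoldsRays` (stmt-17673) holds at
`𝒟` — for EVERY such decomposition the future-complete normalised null rays from `Σ` stay in
`closure O` — then the summit's full T2 settle conjunct holds at `𝒟` (same `O`, same `d`).
Registered sub-goal of stmt-17430 (header on one line = the registered signature).
[cite: DafermosLuk2017, Conjecture 1] -/
theorem settleConjunct_of_rayClauseAt : ∀ {X : Type} [TopologicalSpace X] [ChartedSpace E3 X] [IsManifold (𝓡 3) ∞ X] [ConnectedSpace X] {D : InitialDataSet (𝓡 3) X} {𝒟 : VacuumCauchyDevelopment D}, (∀ (O : Set 𝒟.carrier) (fd : FinalStateDecomposition 𝒟.toSpacetime O 2), (∀ i, Kerr.IsSubextremal (fd.mass i) (fd.spin i)) → O = _root_.Summit.FinalStateConjecture.exteriorOf 𝒟.toCauchyDevelopment fd.charted → _root_.Summit.FinalStateConjecture.HasExhaustiveCharts fd → _root_.Summit.FinalStateConjecture.IsFutureOriented fd → _root_.Summit.FinalStateConjecture.RaysStayInClosure 𝒟.toCauchyDevelopment O) → (∃ (O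 : Set 𝒟.carrier) (d : FinalStateDecomposition 𝒟.toSpacetime O 2), (∀ i, Kerr.IsSubextremal (d.mass i) (d.spin i)) ∧ O = _root_.Summit.FinalStateConjecture.exteriorOf 𝒟.toCauchyDevelopment d.charted ∧ _root_.Summit.FinalStateConjecture.HasExhaustiveCharts d ∧ _root_.Summit.FinalStateConjecture.IsFutureOriented d) → ∃ (O : Set 𝒟.carrier) (d : FinalStateDecomposition 𝒟.toSpacetime O 2), (∀ i, Kerr.IsSubextremal (d.mass i) (d.spin i)) ∧ O = _root_.Summit.FinalStateConjecture.exteriorOf 𝒟.toCauchyDevelopment d.charted ∧ _root_.Summit.FinalStateConjecture.RaysStayInClosure 𝒟.toCauchyDevelopment O ∧ _root_.Summit.FinalStateConjecture.HasExhaustiveCharts d ∧ _root_.Summit.FinalStateConjecture.IsFutureOriented d := by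
  intro X _ _ _ _ D 𝒟 hCat hflat
  obtain ⟨O, d, hsub, hO, hexh, hfo⟩ := hflat
  exact ⟨O, d, hsub, hO, hCat O d hsub hO hexh hfo, hexh, hfo⟩

/-- **Pointwise ray-clause factoring (tame form).** As `settleConjunct_of_rayClauseAt`, for routes whose
(C)-free consequent does not list sub-extremality (as in this route): it is supplied by hypothesis (i)
`TrappedSet.NoExtremalRemnant 𝒟` through `isSubextremal_of_noExtremalRemnant`.
[cite: DafermosLuk2017, Conjecture 1] -/
theorem settleConjunct_of_rayClauseAt_of_noExtremalRemnant : ∀ {X : Type} [TopologicalSpace X] [ChartedSpace E3 X] [IsManifold (𝓡 3) ∞ X] [ConnectedSpace X] {D : InitialDataSet (𝓡 3) X} {𝒟 : VacuumCauchyDevelopment D}, TrappedSet.NoExtremalRemnant 𝒟 → (∀ (O : Set 𝒟.carrier) (fd : FinalStateDecomposition 𝒟.toSpacetime O 2), (∀ i, Kerr.IsSubextremal (fd.mass i) (fd.spin i)) → O = _root_.Summit.FinalStateConjecture.exteriorOf 𝒟.toCauchyDevelopment fd.charted → _root_.Summit.FinalStateConjecture.HasExhaustiveCharts fd → _root_.Summit.FinalStateConjecture.IsFutureOriented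 fd → _root_.Summit.FinalStateConjecture.RaysStayInClosure 𝒟.toCauchyDevelopment O) → (∃ (O : Set 𝒟.carrier) (d : FinalStateDecomposition 𝒟.toSpacetime O 2), O = _root_.Summit.FinalStateConjecture.exteriorOf 𝒟.toCauchyDevelopment d.charted ∧ _root_.Summit.FinalStateConjecture.HasExhaustiveCharts d ∧ _root_.Summit.FinalStateConjecture.IsFutureOriented d) → ∃ (O : Set 𝒟.carrier) (d : FinalStateDecomposition 𝒟.toSpacetime O 2), (∀ i, Kerr.IsSubextremal (d.mass i) (d.spin i)) ∧ O = _root_.Summit.FinalStateConjecture.exteriorOf 𝒟.toCauchyDevelopment d.charted ∧ _root_.Summit.FinalStateConjecture.RaysStayInClosure 𝒟.toCauchyDevelopment O ∧ _root_.Summit.FinalStateConjecture.HasExhaustiveCharts d ∧ _root_.Summit.FinalStateConjecture.IsFutureOriented d := by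
  intro X _ _ _ _ D 𝒟 hi hCat hflat
  obtain ⟨O, d, hO, hexh, hfo⟩ := hflat
  exact settleConjunct_of_rayClauseAt hCat ⟨O, d, isSubextremal_of_noExtremalRemnant hi d, hO, hexh, hfo⟩

end Pointwise

end Summit.FinalStateConjecture.FinalStateConjecture.Theorems.ChannelsResolveTameDevelopmentsR.RayClause
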